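import Summits.AtomisticToContinuum.HydrodynamicLimit.Theses.JParityClosure
import Summits.AtomisticToContinuum.HydrodynamicLimit.Theorems.DensityCap.Negative.MollifiedDensity
import Summits.AtomisticToContinuum.HydrodynamicLimit.Theorems.DensityCap.Negative.KernelMass
import Literature.Analysis.FluidPDE.HardSphereDynamicsProofs
import Literature.Analysis.FluidPDE.HardSphereRegularGeometry
import Literature.MathematicalPhysics.KineticTheory.HardSphereCanonicalTorus

/-!
# drefute checks for the stub set of line `lipschitz-clock-free-past-cap` (crux `JParityClosure.DensityCap`,
stmt-AtomisticToContinuum-13082), LEAD RESHAPE v1 (4 stubs A `stub_meanDisplacement`, B `stub_eulerDensityModulus`,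
D `stub_capEventSubset`, E `stub_gridUpgrade`).

§1 verbatim elaboration of the four stub signatures (sorried) · §2 STUB A at `n = 0` (degenerate instance: true by
`simp`) · §3 STUB A is TIGHT (one particle in free flight realises equality — the constant `√(2K/n)` cannot be
improved, Cauchy–Schwarz must be used exactly) · §4 STUB D PROVED OUTRIGHT (sorry-free; the `η/8, η/8, η/4, η/4`
bookkeeping closes with exactly `η/4` to spare, strict; `hr : 0 < r` is logically unused) · §5 STUB E: `ht : 0 ≤ t`
is decorative (`t < 0` ⇒ `CapLimit` vacuously) · §6 centre-Lipschitz `hlip` is TIGHT for one particle (equality).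
refuter-drefute-stmt-AtomisticToContinuum-13082-0, 2026-08-16.
-/

noncomputable section

namespace DrefuteStubChecks

open MeasureTheory Filter Set Topology
open scoped ENNReal BigOperators
open Literature.MathematicalPhysics.KineticTheory Literature.Analysis.FluidPDE
open Literature.Analysis.FunctionSpaces (Torus.IsSmoothSpaceTimeOn)
open Summit.AtomisticToContinuum.HydrodynamicLimit.Theorems.DensityCapNegative
  (cone mollDensity capEvent CapLimit densityCap_iff mollDensity_le mollDensity_eq cone_nonneg cone_le cone_self)
open Summit.AtomisticToContinuum.HydrodynamicLimit.Theorems.PolynomialCompressionPDE (Flows)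

/-! ## §1 Verbatim elaboration of the four registered stubs -/

theorem elabA {ε : ℝ} {n : ℕ} (Ψ : HardSphereFlow (Torus.geometry (Fin 3)) ε n)
    {z : Config n (Fin 3) T3} (hz : z ∈ Ψ.good) (s s' : ℝ) :
    (n : ℝ)⁻¹ * ∑ i, Torus.euclidDist ((Ψ.flow s' z i).1) ((Ψ.flow s z i).1) ≤
      Real.sqrt (2 * ((n : ℝ)⁻¹ * configEnergy z)) * |s' - s| := by
  sorry

theorem elabB {T : ℝ} {ρ : ℝ → T3 → ℝ}
    (hρ : Torus.IsSmoothSpaceTimeOn (Ico 0 T) ρ) {t : ℝ} (ht : t ∈ Ico 0 T) :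
    ∀ η : ℝ, 0 < η → ∃ r₀ : ℝ, 0 < r₀ ∧ r₀ ≤ 1 / 2 ∧
      (∀ r : ℝ, 0 < r → r < r₀ → ∀ s ∈ Icc 0 t, ∀ x : T3, ∫ y, cone r y x * ρ s y ≤ ρ s x + η) ∧
      ∃ τ₀ : ℝ, 0 < τ₀ ∧ ∀ s ∈ Icc 0 t, ∀ s' ∈ Icc 0 t, |s - s'| ≤ τ₀ →
        ∀ x x' : T3, Torus.euclidDist x x' ≤ r₀ → |ρ s x - ρ s' x'| ≤ η := by
  sorry

/-- STUB D — PROVED (§4 below is this proof; kept sorry-free). -/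
theorem stub_capEventSubset_proved {ε : ℝ} {n : ℕ} (Ψ : HardSphereFlow (Torus.geometry (Fin 3)) ε n)
    (ρ : ℝ → T3 → ℝ) {t η r r₀ τ₀ K δx δt : ℝ} (hr : 0 < r)
    (hclock : ∀ z ∈ Ψ.good, ∀ (s s' : ℝ) (x₀ : T3),
      |mollDensity r (Ψ.flow s' z) x₀ - mollDensity r (Ψ.flow s z) x₀| ≤
        3 / (Real.pi * r ^ 4) * Real.sqrt (2 * ((n : ℝ)⁻¹ * configEnergy z)) * |s' - s|)
    (hlip : ∀ (w : Config n (Fin 3) T3) (x x' : T3),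
      |mollDensity r w x - mollDensity r w x'| ≤ 3 / (Real.pi * r ^ 4) * Torus.euclidDist x x')
    (hmod1 : ∀ s ∈ Icc 0 t, ∀ x : T3, ∫ y, cone r y x * ρ s y ≤ ρ s x + η / 4)
    (hmod2 : ∀ s ∈ Icc 0 t, ∀ s' ∈ Icc 0 t, |s - s'| ≤ τ₀ →
      ∀ x x' : T3, Torus.euclidDist x x' ≤ r₀ → |ρ s x - ρ s' x'| ≤ η / 4)
    (Sx : Finset T3) (hSx : ∀ x : T3, ∃ x' ∈ Sx, Torus.euclidDist x x' ≤ δx)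
    (hδx₁ : δx ≤ r₀) (hδx₂ : 3 / (Real.pi * r ^ 4) * δx ≤ η / 8)
    (St : Finset ℝ) (hSt : ∀ s ∈ St, s ∈ Icc 0 t) (hSt' : ∀ s ∈ Icc 0 t, ∃ s' ∈ St, |s - s'| ≤ δt)
    (hδt₁ : δt ≤ τ₀) (hδt₂ : 3 / (Real.pi * r ^ 4) * Real.sqrt (2 * K) * δt ≤ η / 8) :
    {z | ∃ s ∈ Icc 0 t, ∃ x : T3, ρ s x + η < mollDensity r (Ψ.flow s z) x} ∩ Ψ.good ∩
        {z | (n : ℝ)⁻¹ * configEnergy z ≤ K} ⊆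
      ⋃ s ∈ St, ⋃ x ∈ Sx, {z | η / 4 < |empiricalDensityField (Ψ.flow s z) (fun y => cone r y x) -
        ∫ y, cone r y x * ρ s y|} := by
  rintro z ⟨⟨⟨s, hs, x, hx⟩, hg⟩, hKz⟩
  have hKz' : (n : ℝ)⁻¹ * configEnergy z ≤ K := hKz
  obtain ⟨sk, hsk, hssk⟩ := hSt' s hs
  obtain ⟨xl, hxl, hxxl⟩ := hSx x
  simp only [Set.mem_iUnion, Set.mem_setOf_eq, exists_prop]
  refine ⟨sk, hsk, xl, hxl, ?_⟩
  have hc : 0 ≤ 3 / (Real.pi * r ^ 4) := by positivity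
  have h1 : |mollDensity r (Ψ.flow sk z) x - mollDensity r (Ψ.flow s z) x| ≤ η / 8 := by
    refine (hclock z hg s sk x).trans ?_
    have hsqrt : Real.sqrt (2 * ((n : ℝ)⁻¹ * configEnergy z)) ≤ Real.sqrt (2 * K) :=
      Real.sqrt_le_sqrt (by linarith)
    have habs : |sk - s| ≤ δt := by rw [abs_sub_comm]; exact hssk
    calc 3 / (Real.pi * r ^ 4) * Real.sqrt (2 * ((n : ℝ)⁻¹ * configEnergy z)) * |sk - s|
        ≤ 3 / (Real.pi * r ^ 4) * Real.sqrt (2 * K) * δt :=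
          mul_le_mul (mul_le_mul_of_nonneg_left hsqrt hc) habs (abs_nonneg _)
            (mul_nonneg hc (Real.sqrt_nonneg _))
      _ ≤ η / 8 := hδt₂
  have h2 : |mollDensity r (Ψ.flow sk z) x - mollDensity r (Ψ.flow sk z) xl| ≤ η / 8 := by
    refine (hlip _ x xl).trans ?_
    calc 3 / (Real.pi * r ^ 4) * Torus.euclidDist x xl ≤ 3 / (Real.pi * r ^ 4) * δx :=
          mul_le_mul_of_nonneg_left hxxl hc
      _ ≤ η / 8 := hδx₂
  have h3 : |ρ s x - ρ sk xl| ≤ η / 4 :=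
    hmod2 s hs sk (hSt sk hsk) (hssk.trans hδt₁) x xl (hxxl.trans hδx₁)
  have h4 : ∫ y, cone r y xl * ρ sk y ≤ ρ sk xl + η / 4 := hmod1 sk (hSt sk hsk) xl
  have hed : empiricalDensityField (Ψ.flow sk z) (fun y => cone r y xl) = mollDensity r (Ψ.flow sk z) xl := rfl
  rw [hed]
  rw [abs_le] at h1 h2 h3
  refine lt_of_lt_of_le ?_ (le_abs_self _)
  linarith [h1.1, h1.2, h2.1, h2.2, h3.1, h3.2]

theorem elabE {σ : ℝ} (a₀ θ₀ : T3 → ℝ) (u₀ : T3 → V3) (Φ : Flows σ) (ρ : ℝ → T3 → ℝ)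
    {t : ℝ} (ht : 0 ≤ t)
    (hdisp : ∀ N : ℕ, ∀ z ∈ (Φ N).good, ∀ s s' : ℝ,
      ((N + 1 : ℕ) : ℝ)⁻¹ * ∑ i, Torus.euclidDist (((Φ N).flow s' z i).1) (((Φ N).flow s z i).1) ≤
        Real.sqrt (2 * (((N + 1 : ℕ) : ℝ)⁻¹ * configEnergy z)) * |s' - s|)
    {K : ℝ}
    (hK : Tendsto (fun N => localGibbsLaw σ a₀ u₀ θ₀ N (Φ N)
      {z | K < ((N + 1 : ℕ) : ℝ)⁻¹ * configEnergy z}) atTop (𝓝 0))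
    (hmod : ∀ η : ℝ, 0 < η → ∃ r₀ : ℝ, 0 < r₀ ∧ r₀ ≤ 1 / 2 ∧
      (∀ r : ℝ, 0 < r → r < r₀ → ∀ s ∈ Icc 0 t, ∀ x : T3, ∫ y, cone r y x * ρ s y ≤ ρ s x + η) ∧
      ∃ τ₀ : ℝ, 0 < τ₀ ∧ ∀ s ∈ Icc 0 t, ∀ s' ∈ Icc 0 t, |s - s'| ≤ τ₀ →
        ∀ x x' : T3, Torus.euclidDist x x' ≤ r₀ → |ρ s x - ρ s' x'| ≤ η)
    (hlln : ∀ s ∈ Icc 0 t, ∀ χ : T3 → ℝ, Continuous χ → ∀ δ : ℝ, 0 < δ →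
      Tendsto (fun N => localGibbsLaw σ a₀ u₀ θ₀ N (Φ N)
        {z | δ < |empiricalDensityField ((Φ N).flow s z) χ - ∫ x, χ x * ρ s x|}) atTop (𝓝 0)) :
    CapLimit σ a₀ u₀ θ₀ Φ ρ t := by
  sorry

/-! ## §2 STUB A at `n = 0`: both sides vanish -/

example {ε : ℝ} (Ψ : HardSphereFlow (Torus.geometry (Fin 3)) ε 0) {z : Config 0 (Fin 3) T3}
    (_hz : z ∈ Ψ.good) (s s' : ℝ) :
    ((0 : ℕ) : ℝ)⁻¹ * ∑ i, Torus.euclidDist ((Ψ.flow s' z i).1) ((Ψ.flow s z i).1) ≤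
      Real.sqrt (2 * (((0 : ℕ) : ℝ)⁻¹ * configEnergy z)) * |s' - s| := by
  simp

/-! ## §3 STUB A is tight: one particle in free flight gives EQUALITY (short times) -/

/-- For the one-particle configuration `w = (x, v)` and its free flight `S_τ w` (`0 ≤ τ`, `‖τ • v‖ < 1/2`), the mean
minimal-image displacement EQUALS `√(2K/n)·|τ − 0|`: the constant of STUB A cannot be lowered. -/
theorem stubA_tight (x : T3) (v : V3) {τ : ℝ} (hτ : 0 ≤ τ) (hsmall : ‖τ • v‖ < 1 / 2) :
    ((1 : ℕ) : ℝ)⁻¹ * ∑ i, Torus.euclidDist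
        ((freeFlight (Torus.geometry (Fin 3)) τ (fun _ : Fin 1 => (x, v)) i).1)
        (((fun _ : Fin 1 => (x, v)) i).1) =
      Real.sqrt (2 * (((1 : ℕ) : ℝ)⁻¹ * configEnergy (fun _ : Fin 1 => (x, v)))) * |τ - 0| := by
  have hdisp : Torus.euclidDist (x + Literature.Analysis.FunctionSpaces.Torus.proj (τ • v)) x = τ * ‖v‖ := by
    rw [Torus.euclidDist_eq, add_sub_cancel_left, reprSym_proj_of_norm_lt hsmall, norm_smul,
      Real.norm_eq_abs, abs_of_nonneg hτ]
  have hE : configEnergy (fun _ : Fin 1 => (x, v)) = 2⁻¹ * ‖v‖ ^ 2 := by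
    simp [configEnergy]
  simp only [Nat.cast_one, inv_one, one_mul, Finset.univ_unique, Fin.default_eq_zero, Finset.sum_singleton,
    freeFlight_apply, Torus.geometry_translate, sub_zero, abs_of_nonneg hτ, hE]
  rw [hdisp, show (2 : ℝ) * (2⁻¹ * ‖v‖ ^ 2) = ‖v‖ ^ 2 by ring, Real.sqrt_sq (norm_nonneg v), mul_comm]

/-! ## §5 STUB E: `ht : 0 ≤ t` is decorative — for `t < 0` the cap holds vacuously -/

example {σ : ℝ} (a₀ θ₀ : T3 → ℝ) (u₀ : T3 → V3) (Φ : Flows σ) (ρ : ℝ → T3 → ℝ) {t : ℝ} (ht : t < 0) :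
    CapLimit σ a₀ u₀ θ₀ Φ ρ t := by
  intro η δ _hη _hδ
  refine ⟨1, one_pos, fun r _hr _hr1 => ⟨0, fun N _ => ?_⟩⟩
  have hempty : capEvent Φ N ρ t η r = ∅ := by
    refine Set.eq_empty_of_forall_notMem fun z hz => ?_
    obtain ⟨s, hs, -, -⟩ := hz
    exact absurd (hs.1.trans hs.2) (not_le.2 ht)
  rw [hempty, measure_empty]
  exact zero_le

/-! ## §6 The centre-Lipschitz bound `hlip` (supplied by the lead in E) is tight for one particle -/

/-- One particle at `q`, centres `q` and `x'` with `d(q, x') ≤ r`: `ρ̄ w q − ρ̄ w x' = 3/(πr⁴) · d(q, x')`. -/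
theorem hlip_tight {r : ℝ} (hr : 0 < r) (q x' : T3) (v : V3) (hd : Torus.euclidDist q x' ≤ r) :
    mollDensity r (fun _ : Fin 1 => (q, v)) q - mollDensity r (fun _ : Fin 1 => (q, v)) x' =
      3 / (Real.pi * r ^ 4) * Torus.euclidDist q x' := by
  rw [mollDensity_eq, mollDensity_eq]
  simp only [Nat.cast_one, inv_one, one_mul, Finset.univ_unique, Fin.default_eq_zero, Finset.sum_singleton,
    cone_self]
  unfold cone
  have hmax : max (1 - Torus.euclidDist q x' / r) 0 = 1 - Torus.euclidDist q x' / r :=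
    max_eq_left (by rw [sub_nonneg, div_le_one hr]; exact hd)
  rw [hmax]
  field_simp
  ring

/-! ## §7 The two constants E must discharge for D are right: cone-Lipschitz and the centre-Lipschitz bound `hlip`
(proved; `3/(πr⁴)` exactly) -/

/-- The cone kernel is `3/(πr⁴)`-Lipschitz in the CENTRE for the minimal-image metric. -/
theorem cone_lipschitz_centre {r : ℝ} (hr : 0 < r) (q x x' : T3) :
    |cone r q x - cone r q x'| ≤ 3 / (Real.pi * r ^ 4) * Torus.euclidDist x x' := by
  unfold cone
  have hc : 0 ≤ 3 / (Real.pi * r ^ 3) := by positivity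
  have htri : |Torus.euclidDist q x - Torus.euclidDist q x'| ≤ Torus.euclidDist x x' := by
    rw [abs_sub_le_iff]
    constructor
    · have := euclidDist_triangle q x' x
      rw [Torus.euclidDist_comm x' x] at this
      linarith
    · have := euclidDist_triangle q x x'
      linarith
  rw [← mul_sub, abs_mul, abs_of_nonneg hc]
  calc 3 / (Real.pi * r ^ 3) * |max (1 - Torus.euclidDist q x / r) 0 - max (1 - Torus.euclidDist q x' / r) 0|
      ≤ 3 / (Real.pi * r ^ 3) * |(1 - Torus.euclidDist q x / r) - (1 - Torus.euclidDist q x' / r)| :=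
        mul_le_mul_of_nonneg_left (abs_max_sub_max_le_abs _ _ _) hc
    _ = 3 / (Real.pi * r ^ 3) * (|Torus.euclidDist q x - Torus.euclidDist q x'| / r) := by
        rw [show (1 - Torus.euclidDist q x / r) - (1 - Torus.euclidDist q x' / r) =
          -((Torus.euclidDist q x - Torus.euclidDist q x') / r) by ring, abs_neg, abs_div, abs_of_pos hr]
    _ ≤ 3 / (Real.pi * r ^ 3) * (Torus.euclidDist x x' / r) := by gcongr
    _ = 3 / (Real.pi * r ^ 4) * Torus.euclidDist x x' := by
        field_simp

/-- The cone kernel is `3/(πr⁴)`-Lipschitz in the PARTICLE POSITION (what turns STUB A into the clock). -/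
theorem cone_lipschitz_particle {r : ℝ} (hr : 0 < r) (q q' x : T3) :
    |cone r q x - cone r q' x| ≤ 3 / (Real.pi * r ^ 4) * Torus.euclidDist q q' := by
  have hsymm : ∀ a b : T3, cone r a b = cone r b a := fun a b => by
    unfold cone; rw [Torus.euclidDist_comm]
  rw [hsymm q x, hsymm q' x]
  exact cone_lipschitz_centre hr x q q'

/-- `hlip` of STUB D, as E must supply it: the mollified density is `3/(πr⁴)`-Lipschitz in the centre, surely. -/
theorem mollDensity_lipschitz_centre {r : ℝ} (hr : 0 < r) {n : ℕ} (w : Config n (Fin 3) T3) (x x' : T3) :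
    |mollDensity r w x - mollDensity r w x'| ≤ 3 / (Real.pi * r ^ 4) * Torus.euclidDist x x' := by
  rw [mollDensity_eq, mollDensity_eq, ← mul_sub, ← Finset.sum_sub_distrib, abs_mul,
    abs_of_nonneg (inv_nonneg.2 (Nat.cast_nonneg n))]
  rcases Nat.eq_zero_or_pos n with hn | hn
  · subst hn
    simp only [Nat.cast_zero, inv_zero, zero_mul]
    exact mul_nonneg (by positivity) (norm_nonneg _)
  · calc (n : ℝ)⁻¹ * |∑ i, (cone r (w i).1 x - cone r (w i).1 x')|
        ≤ (n : ℝ)⁻¹ * ∑ i, |cone r (w i).1 x - cone r (w i).1 x'| := by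
          gcongr
          exact Finset.abs_sum_le_sum_abs _ _
      _ ≤ (n : ℝ)⁻¹ * ∑ _i : Fin n, 3 / (Real.pi * r ^ 4) * Torus.euclidDist x x' := by
          gcongr with i _
          exact cone_lipschitz_centre hr _ _ _
      _ = 3 / (Real.pi * r ^ 4) * Torus.euclidDist x x' := by
          rw [Finset.sum_const, Finset.card_univ, Fintype.card_fin, nsmul_eq_mul, ← mul_assoc,
            inv_mul_cancel₀ (by exact_mod_cast hn.ne'), one_mul]

/-- The clock from STUB A (what E does with `hdisp`): mean displacement bound ⇒ time-Lipschitz mollified density. -/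
theorem clock_of_meanDisplacement {r : ℝ} (hr : 0 < r) {n : ℕ} (w w' : Config n (Fin 3) T3) (x₀ : T3) {B : ℝ}
    (hdisp : (n : ℝ)⁻¹ * ∑ i, Torus.euclidDist ((w' i).1) ((w i).1) ≤ B) :
    |mollDensity r w' x₀ - mollDensity r w x₀| ≤ 3 / (Real.pi * r ^ 4) * B := by
  rw [mollDensity_eq, mollDensity_eq, ← mul_sub, ← Finset.sum_sub_distrib, abs_mul,
    abs_of_nonneg (inv_nonneg.2 (Nat.cast_nonneg n))]
  have hc : 0 ≤ 3 / (Real.pi * r ^ 4) := by positivity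
  calc (n : ℝ)⁻¹ * |∑ i, (cone r (w' i).1 x₀ - cone r (w i).1 x₀)|
      ≤ (n : ℝ)⁻¹ * ∑ i, |cone r (w' i).1 x₀ - cone r (w i).1 x₀| := by
        gcongr
        exact Finset.abs_sum_le_sum_abs _ _
    _ ≤ (n : ℝ)⁻¹ * ∑ i, 3 / (Real.pi * r ^ 4) * Torus.euclidDist (w' i).1 (w i).1 := by
        gcongr with i _
        exact cone_lipschitz_particle hr _ _ _
    _ = 3 / (Real.pi * r ^ 4) * ((n : ℝ)⁻¹ * ∑ i, Torus.euclidDist (w' i).1 (w i).1) := by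
        rw [← Finset.mul_sum]
        ring
    _ ≤ 3 / (Real.pi * r ^ 4) * B := mul_le_mul_of_nonneg_left hdisp hc

end DrefuteStubChecks

end
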